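import Summits.ABC.StewartYu.GenThreeVanishingShift
import HarnessLib

/-!
# Cell abc-stewartyu, Gen-3 frames: binomial recombination of the directional scalars on a
# downward-closed multi-index range (the algebra of every re-indexing / re-centring step)

`Summits/ABC/StewartYu/DirectionalRecombination.lean` — cell `abc-stewartyu` (route `PadicPrimesKummerThird`,
cruxes `Y07Odd` stmt-ABC-19658 / `Y07Two` stmt-ABC-19659), seat p3 (g4), F-two lead; brick (b) of
HOME/p3/memo-08 §5 in its place-free core.  Theorems only.

In the Gen-3 frames the `n − 1` directional derivations act on a monomial `Y^𝐥` by the scalars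
`𝔛ₖ(𝐥) = b_{j₀} lₖ − bₖ l_{j₀}`, and every bookkeeping step replaces `𝐥` by an affine image:
the `q`-descent re-indexing `𝐥 = q·ρ + v` (Nesterenko 2003 §4.3 at `q = 2`; the cell's base-`3` layer at
`p = 2`: `𝔛ₖ(3ρ + v) = 3𝔛ₖ(ρ) + 𝔛ₖ(v)`), the re-centring `𝐥 − 𝐰_s` of (3.28)/(3.34), the Laurent shift
`κ + D` of (5.3).  Since the identities come for ALL multi-indices `ν ≤ μ` (a downward-closed range), any
such affine substitution of the scalars preserves them:

* `sum_mul_prod_affine_pow_eq_zero` — if `∑ᵢ cᵢ ∏ₖ Lᵢₖ^{νₖ} = 0` for all `ν ≤ μ` (componentwise), then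
  `∑ᵢ cᵢ ∏ₖ (uₖ Lᵢₖ + sₖ)^{μₖ} = 0` for all scalings `u` and shifts `s` (multi-binomial expansion
  `GenThreeVanishing.prod_add_pow_eq_sum`);
* `sum_mul_prod_affine_pow_eq_zero_of_total` — the same on the total-degree-bounded range
  `∑ νₖ ≤ T` (the shape of the frames' identities `t + ∑ μₖ ≤ T`).

References: Yu. V. Nesterenko, LNM 1819 (2003), (3.28)–(3.30), §4.3 (4.50)–(4.51), (5.3)–(5.4).
-/

noncomputable section

open Finset

namespace Summit.ABC.StewartYu.GenThreeVanishing

variable {m : ℕ}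

/-- **Binomial recombination on a componentwise downward-closed range**: identities for all `ν ≤ μ`
survive any affine substitution `Lᵢₖ ↦ uₖ Lᵢₖ + sₖ` of the directional scalars.
[cite: Nesterenko2003, §4.3 (4.50)–(4.51)] -/
theorem sum_mul_prod_affine_pow_eq_zero {ι : Type*} (I : Finset ι) (c : ι → ℂ) (L : ι → Fin m → ℂ)
    (u s : Fin m → ℂ) (μ : Fin m → ℕ)
    (h : ∀ ν : Fin m → ℕ, (∀ k, ν k ≤ μ k) → ∑ i ∈ I, c i * ∏ k, L i k ^ ν k = 0) :
    ∑ i ∈ I, c i * ∏ k, (u k * L i k + s k) ^ μ k = 0 := by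
  classical
  have hexp : ∀ i, ∏ k, (u k * L i k + s k) ^ μ k =
      ∑ ν ∈ Fintype.piFinset fun k => Finset.range (μ k + 1),
        (∏ k, (((μ k).choose (ν k) : ℕ) : ℂ) * u k ^ ν k * s k ^ (μ k - ν k)) * ∏ k, L i k ^ ν k := by
    intro i
    rw [prod_add_pow_eq_sum]
    refine Finset.sum_congr rfl fun ν _ => ?_
    rw [← Finset.prod_mul_distrib]
    refine Finset.prod_congr rfl fun k _ => ?_
    rw [mul_pow]; ring
  calc ∑ i ∈ I, c i * ∏ k, (u k * L i k + s k) ^ μ k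
      = ∑ i ∈ I, ∑ ν ∈ Fintype.piFinset fun k => Finset.range (μ k + 1),
          (∏ k, (((μ k).choose (ν k) : ℕ) : ℂ) * u k ^ ν k * s k ^ (μ k - ν k)) *
            (c i * ∏ k, L i k ^ ν k) := by
        refine Finset.sum_congr rfl fun i _ => ?_
        rw [hexp i, Finset.mul_sum]
        refine Finset.sum_congr rfl fun ν _ => by ring
    _ = ∑ ν ∈ Fintype.piFinset fun k => Finset.range (μ k + 1),
          (∏ k, (((μ k).choose (ν k) : ℕ) : ℂ) * u k ^ ν k * s k ^ (μ k - ν k)) *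
            ∑ i ∈ I, c i * ∏ k, L i k ^ ν k := by
        rw [Finset.sum_comm]
        refine Finset.sum_congr rfl fun ν _ => by rw [Finset.mul_sum]
    _ = 0 := by
        refine Finset.sum_eq_zero fun ν hν => ?_
        rw [h ν (le_of_mem_piFinset_range hν), mul_zero]

/-- **The same on the total-degree range** `∑ₖ νₖ ≤ T` (with an optional pinned coordinate
`ν_{j₀} = 0`, as in the frames' identity families): if the identities hold for all `ν` with
`ν_{j₀} = 0` and `∑ νₖ ≤ T`, then for every `μ` with `μ_{j₀} = 0`, `∑ μₖ ≤ T` the affinely substituted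
identity holds. [cite: Nesterenko2003, (5.3)–(5.4)] -/
theorem sum_mul_prod_affine_pow_eq_zero_of_total {ι : Type*} (I : Finset ι) (c : ι → ℂ)
    (L : ι → Fin m → ℂ) (u s : Fin m → ℂ) (j₀ : Fin m) (T : ℕ)
    (h : ∀ ν : Fin m → ℕ, ν j₀ = 0 → ∑ k, ν k ≤ T → ∑ i ∈ I, c i * ∏ k, L i k ^ ν k = 0)
    (μ : Fin m → ℕ) (hμ : μ j₀ = 0) (hT : ∑ k, μ k ≤ T) :
    ∑ i ∈ I, c i * ∏ k, (u k * L i k + s k) ^ μ k = 0 := by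
  refine sum_mul_prod_affine_pow_eq_zero I c L u s μ fun ν hν => h ν ?_ ?_
  · have := hν j₀; omega
  · exact le_trans (Finset.sum_le_sum fun k _ => hν k) hT

end Summit.ABC.StewartYu.GenThreeVanishing

end
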